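import Summits.Ventures.PercRepro.ProfilePointedContractionSplit

/-!
# PercRepro — THE COLOOP LIMIT AT A TRIANGLE, I: TRIANGLES, THE FAMILIES `F₁`, `P₁′`, `F₂` AND THE MAP `τ`
(p10, gen 17; `proofs/P10-AVFULL.md` §25(l); the identity itself is in ProfilePointedTriangleIdentity)

Let `{p, e, b}` be a triangle (a 3-circuit) of the finite matroid `M` through the point `p` (`IsTriangle`), and
`𝒦 = capSets M p` the captured family (`X`, `E ∖ X` independent, `p ∉ X`, `p ∈ cl X`; `Y := (E ∖ X) ∖ p`).  Every
captured set contains `e` or `b` (`mem_or_mem_of_triangle`), and a captured set containing both has the triangle as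
its fundamental circuit of `p` (`notMem_clF_erase_of_mem_of_mem`).  On the `e`-avoiding captured sets two maps act:

* `σ : X ↦ (X ∖ b) ∪ e` on `F₁ = {X ∈ 𝒦 : e ∉ X, p ∈ cl (X ∖ b)}` (`triF1`) is a size-preserving bijection onto the
  sets of `restPart e` avoiding `b` (`sum_restPart_notMem_eq_sum_triF1`);
* `τ : X ↦ Y ∪ b` on `P₁′ = {X ∈ 𝒦 : e ∉ X, p ∉ cl (X ∖ b)}` (`triP1'`) reverses `2 #X − N`, lands in
  `swapPart e ∪ restPart e`, and every set of `restPart e` containing `b` is a `τ`-image (`tau_mem_capSets`,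
  `sum_restPart_mem_eq_neg_sum`).

With the contraction split (`sum_capSets_signed_eq_contract_split`) and the parallel-pair theorem for `M ／ e` (where
`p ∥ b`, so `Φ(M ／ e, p) = 0`) this gives THE IDENTITY (`sum_capSets_signed_triangle`)

  `Φ(M, p) = #𝒦(M ／ e, p) + 2 · Σ_{X ∈ F₁} (2 #X − N) + Σ_{X ∈ F₂} (2 #X − N)`,

`F₂ = {X ∈ P₁′ : τ X ∈ swapPart e}` (`triF2`).  So the conjecture (TRI) «`Φ(M, p) ≥ #𝒦(M ／ e, p)`» (`TriangleStep`,
100th module) is, at each triangle, the inequality `2 · Σ_{F₁} (2 #X − N) + Σ_{F₂} (2 #X − N) ≥ 0`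
(`triangleStep_iff_weighted`), a statement about the `e`-avoiding captured sets alone; on every triangle instance with
≤ 8 elements both sums are ≥ 0 separately (census, not asserted).  Nothing here asserts (TRI) or (C1′).
-/

open scoped Matroid

namespace PercRepro.Cogirth

open Finset ThmH Skew

variable {α : Type} [DecidableEq α] {M : Matroid α} [M.Finite]

/-! ### Triangles -/

/-- A triangle `{p, e, b}` through `p`: three distinct non-parallel non-loops spanning a line. -/
structure IsTriangle (M : Matroid α) [M.Finite] (p e b : α) : Prop where
  hp : p ∈ gr M
  he : e ∈ gr M
  hb : b ∈ gr M
  hpe : p ≠ e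
  hpb : p ≠ b
  heb : e ≠ b
  rpe : rk M {p, e} = 2
  rpb : rk M {p, b} = 2
  reb : rk M {e, b} = 2
  rpeb : rk M {p, e, b} = 2

variable {p e b : α}

/-- If `z ∈ cl {x, y}` and `x, y ∈ cl S` then `z ∈ cl S` (rank squeeze; no closure idempotence needed). -/
theorem mem_clF_of_mem_clF_pair {x y z : α} (hxg : x ∈ gr M) (hyg : y ∈ gr M) (hz : z ∈ gr M)
    (hzxy : z ∈ clF M {x, y}) {S : Finset α} (hS : S ⊆ gr M) (hx : x ∈ clF M S) (hy : y ∈ clF M S) :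
    z ∈ clF M S := by
  have hS1 : insert x S ⊆ gr M := insert_subset hxg hS
  have hS2 : insert y (insert x S) ⊆ gr M := insert_subset hyg hS1
  have h1 : rk M (insert x S) = rk M S := (mem_clF_iff_rk_insert_eq hxg hS).1 hx
  have hy' : y ∈ clF M (insert x S) := clF_mono_sub (subset_insert x S) hy
  have h2 : rk M (insert y (insert x S)) = rk M (insert x S) := (mem_clF_iff_rk_insert_eq hyg hS1).1 hy'
  have hz' : z ∈ clF M (insert y (insert x S)) := by
    apply clF_mono_sub _ hzxy
    intro w hw
    rw [mem_insert, mem_singleton] at hw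
    rcases hw with rfl | rfl
    · exact mem_insert_of_mem (mem_insert_self _ _)
    · exact mem_insert_self _ _
  have h3 : rk M (insert z (insert y (insert x S))) = rk M (insert y (insert x S)) :=
    (mem_clF_iff_rk_insert_eq hz hS2).1 hz'
  rw [mem_clF_iff_rk_insert_eq hz hS]
  have h4 : rk M S ≤ rk M (insert z S) := rk_mono' (subset_insert z S)
  have h5 : rk M (insert z S) ≤ rk M (insert z (insert y (insert x S))) :=
    rk_mono' (insert_subset_insert z ((subset_insert x S).trans (subset_insert y _)))
  omega

/-- The three closure relations of a triangle. -/
theorem IsTriangle.p_mem_clF (hT : IsTriangle M p e b) : p ∈ clF M {e, b} := by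
  rw [mem_clF_iff_rk_insert_eq hT.hp (insert_subset hT.he (singleton_subset_iff.2 hT.hb)), hT.rpeb, hT.reb]

/-- `e ∈ cl {p, b}`. -/
theorem IsTriangle.e_mem_clF (hT : IsTriangle M p e b) : e ∈ clF M {p, b} := by
  rw [mem_clF_iff_rk_insert_eq hT.he (insert_subset hT.hp (singleton_subset_iff.2 hT.hb)), insert_comm, hT.rpeb,
    hT.rpb]

/-- `b ∈ cl {p, e}`. -/
theorem IsTriangle.b_mem_clF (hT : IsTriangle M p e b) : b ∈ clF M {p, e} := by
  have h : ({b, p, e} : Finset α) = {p, e, b} := by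
    rw [insert_comm b p, pair_comm b e]
  rw [mem_clF_iff_rk_insert_eq hT.hb (insert_subset hT.hp (singleton_subset_iff.2 hT.he)), h, hT.rpeb, hT.rpe]

/-- `p, b ∈ cl S ⟹ e ∈ cl S`. -/
theorem IsTriangle.e_mem_clF_of (hT : IsTriangle M p e b) {S : Finset α} (hS : S ⊆ gr M) (hp : p ∈ clF M S)
    (hb : b ∈ clF M S) : e ∈ clF M S :=
  mem_clF_of_mem_clF_pair hT.hp hT.hb hT.he hT.e_mem_clF hS hp hb

/-- `p, e ∈ cl S ⟹ b ∈ cl S`. -/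
theorem IsTriangle.b_mem_clF_of (hT : IsTriangle M p e b) {S : Finset α} (hS : S ⊆ gr M) (hp : p ∈ clF M S)
    (he : e ∈ clF M S) : b ∈ clF M S :=
  mem_clF_of_mem_clF_pair hT.hp hT.he hT.hb hT.b_mem_clF hS hp he

/-- `e, b ∈ cl S ⟹ p ∈ cl S`. -/
theorem IsTriangle.p_mem_clF_of (hT : IsTriangle M p e b) {S : Finset α} (hS : S ⊆ gr M) (he : e ∈ clF M S)
    (hb : b ∈ clF M S) : p ∈ clF M S :=
  mem_clF_of_mem_clF_pair hT.he hT.hb hT.hp hT.p_mem_clF hS he hb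

/-- `z ∉ cl (S ∖ z)` for an independent `S ∋ z`. -/
theorem notMem_clF_erase_of_rk_eq_card {z : α} (hz : z ∈ gr M) {S : Finset α} (hS : S ⊆ gr M)
    (hSr : rk M S = S.card) (hzS : z ∈ S) : z ∉ clF M (S.erase z) := by
  rw [mem_clF_iff_rk_insert_eq hz ((erase_subset _ _).trans hS), insert_erase hzS, hSr]
  have := rk_le_card (M := M) (S.erase z)
  rw [card_erase_of_mem hzS] at this
  have := card_pos.2 ⟨z, hzS⟩
  omega

/-- A point not in an independent set `S` with `S ∪ z` independent is not spanned by `S`. -/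
theorem notMem_clF_of_rk_insert {z : α} (hz : z ∈ gr M) {S : Finset α} (hS : S ⊆ gr M)
    (hzS : z ∉ S) (hr : rk M (insert z S) = (insert z S).card) : z ∉ clF M S := by
  rw [mem_clF_iff_rk_insert_eq hz hS, hr, card_insert_of_notMem hzS]
  have := rk_le_card (M := M) S
  omega

/-! ### Captured sets at a triangle -/

/-- Every captured set contains `e` or `b`: otherwise the triangle would sit inside the independent `E ∖ X`. -/
theorem IsTriangle.mem_or_mem (hT : IsTriangle M p e b) {X : Finset α} (hX : X ∈ capSets M p) :
    e ∈ X ∨ b ∈ X := by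
  by_contra h
  rw [not_or] at h
  obtain ⟨⟨hXb, hpX⟩, -⟩ := mem_capSets.1 hX
  have hXc := (mem_biIndepAll.1 hXb).2.2
  have hsub : ({p, e, b} : Finset α) ⊆ gr M \ X := by
    intro w hw
    rw [mem_insert, mem_insert, mem_singleton] at hw
    rw [mem_sdiff]
    rcases hw with rfl | rfl | rfl
    · exact ⟨hT.hp, hpX⟩
    · exact ⟨hT.he, h.1⟩
    · exact ⟨hT.hb, h.2⟩
  have h1 := rk_eq_card_of_subset_of_rk_eq_card hsub hXc
  rw [hT.rpeb, card_insert_of_notMem (by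
      rw [mem_insert, mem_singleton, not_or]
      exact ⟨hT.hpe, hT.hpb⟩), card_insert_of_notMem (by rw [mem_singleton]; exact hT.heb),
    card_singleton] at h1
  omega

/-- A captured set containing `e` and `b` has the triangle as fundamental circuit of `p`: `p ∉ cl (X ∖ e)`. -/
theorem IsTriangle.notMem_clF_erase_of_mem_of_mem (hT : IsTriangle M p e b) {X : Finset α}
    (hX : X ∈ capSets M p) (heX : e ∈ X) (hbX : b ∈ X) : p ∉ clF M (X.erase e) := by
  intro hcl
  obtain ⟨⟨hXb, hpX⟩, -⟩ := mem_capSets.1 hX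
  obtain ⟨hXg, hXr, -⟩ := mem_biIndepAll.1 hXb
  have hXeg : X.erase e ⊆ gr M := (erase_subset _ _).trans hXg
  have hbe : b ∈ clF M (X.erase e) :=
    subset_clF_self_of_subset_gr hXeg (mem_erase.2 ⟨hT.heb.symm, hbX⟩)
  have he : e ∈ clF M (X.erase e) := hT.e_mem_clF_of hXeg hcl hbe
  exact notMem_clF_erase_of_rk_eq_card hT.he hXg hXr heX he

/-- The same with the roles of `e` and `b` exchanged. -/
theorem IsTriangle.notMem_clF_erase_of_mem_of_mem' (hT : IsTriangle M p e b) {X : Finset α}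
    (hX : X ∈ capSets M p) (heX : e ∈ X) (hbX : b ∈ X) : p ∉ clF M (X.erase b) := by
  intro hcl
  obtain ⟨⟨hXb, hpX⟩, -⟩ := mem_capSets.1 hX
  obtain ⟨hXg, hXr, -⟩ := mem_biIndepAll.1 hXb
  have hXbg : X.erase b ⊆ gr M := (erase_subset _ _).trans hXg
  have hee : e ∈ clF M (X.erase b) :=
    subset_clF_self_of_subset_gr hXbg (mem_erase.2 ⟨hT.heb, heX⟩)
  have hb : b ∈ clF M (X.erase b) := hT.b_mem_clF_of hXbg hcl hee
  exact notMem_clF_erase_of_rk_eq_card hT.hb hXg hXr hbX hb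

/-! ### The families `F₁`, `P₁′`, `F₂` -/

/-- `F₁`: the `e`-avoiding captured sets with `p ∈ cl (X ∖ b)`. -/
noncomputable def triF1 (M : Matroid α) [M.Finite] (p e b : α) : Finset (Finset α) :=
  (capSets M p).filter (fun X => e ∉ X ∧ p ∈ clF M (X.erase b))

/-- `P₁′`: the `e`-avoiding captured sets with `p ∉ cl (X ∖ b)` — the domain of `τ`. -/
noncomputable def triP1' (M : Matroid α) [M.Finite] (p e b : α) : Finset (Finset α) :=
  (capSets M p).filter (fun X => e ∉ X ∧ p ∉ clF M (X.erase b))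

/-- `τ X = ((E ∖ X) ∖ p) ∪ b`. -/
noncomputable def tau (M : Matroid α) [M.Finite] (p b : α) (X : Finset α) : Finset α :=
  insert b ((gr M \ X).erase p)

/-- `F₂`: the members of `P₁′` whose `τ`-image lies in `swapPart e`. -/
noncomputable def triF2 (M : Matroid α) [M.Finite] (p e b : α) : Finset (Finset α) :=
  (triP1' M p e b).filter (fun X => tau M p b X ∈ swapPart M p e)

/-- The `e`-avoiding captured sets split into `F₁` and `P₁′`. -/
theorem sum_avoidPart_eq_triF1_add_triP1' (p e b : α) :
    ∑ X ∈ avoidPart M p e, (2 * (X.card : ℤ) - (gr M).card) =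
      ∑ X ∈ triF1 M p e b, (2 * (X.card : ℤ) - (gr M).card) +
        ∑ X ∈ triP1' M p e b, (2 * (X.card : ℤ) - (gr M).card) := by
  unfold avoidPart triF1 triP1'
  rw [← sum_filter_add_sum_filter_not ((capSets M p).filter (fun X => e ∉ X)) (fun X => p ∈ clF M (X.erase b)),
    filter_filter, filter_filter]

/-- `τ` is injective on `p`-avoiding subsets of `E` avoiding `b`... its left inverse is `Z ↦ ((E ∖ Z) ∖ p) ∪ b`
as well; for `X ∈ 𝒦` with `b ∈ X`: `τ (τ X) = X`. -/
theorem tau_tau {p b : α} (hp : p ∈ gr M) (hpb : p ≠ b) {X : Finset α} (hXg : X ⊆ gr M) (hpX : p ∉ X)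
    (hbX : b ∈ X) : tau M p b (tau M p b X) = X := by
  unfold tau
  rw [sdiff_insert, sdiff_sdiff_erase hp hXg hpX, erase_insert_of_ne hpb,
    erase_insert (fun h => hpX (mem_of_mem_erase h)), insert_erase hbX]

/-- `#(τ X) + #X = N` for `X ∈ 𝒦` with `b ∈ X`. -/
theorem card_tau_add {p b : α} (hp : p ∈ gr M) {X : Finset α} (hX : X ∈ capSets M p) (hbX : b ∈ X) :
    (tau M p b X).card + X.card = (gr M).card := by
  have hbY : b ∉ (gr M \ X).erase p := fun h => (mem_sdiff.1 (mem_of_mem_erase h)).2 hbX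
  unfold tau
  rw [card_insert_of_notMem hbY]
  have := card_pSide_add hp hX
  omega

/-- **`τ` LANDS IN `𝒦`**: for `X ∈ P₁′`, `τ X = Y ∪ b` is captured, contains `e`, and `e ∈ cl (E ∖ τ X)`;
moreover `E ∖ τ X = (X ∖ b) ∪ p`. -/
theorem IsTriangle.tau_mem (hT : IsTriangle M p e b) {X : Finset α} (hX : X ∈ triP1' M p e b) :
    tau M p b X ∈ capSets M p ∧ e ∈ tau M p b X ∧ e ∈ clF M (gr M \ tau M p b X) ∧
      gr M \ tau M p b X = insert p (X.erase b) := by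
  unfold triP1' at hX
  rw [mem_filter] at hX
  obtain ⟨hXK, heX, hpXb⟩ := hX
  have hbX : b ∈ X := (hT.mem_or_mem hXK).resolve_left heX
  obtain ⟨⟨hXb, hpX⟩, hpcl⟩ := mem_capSets.1 hXK
  obtain ⟨hXg, hXr, hXc⟩ := mem_biIndepAll.1 hXb
  have hpZ : p ∈ gr M \ X := mem_sdiff.2 ⟨hT.hp, hpX⟩
  set Y := (gr M \ X).erase p with hYdef
  have hYg : Y ⊆ gr M := (erase_subset _ _).trans sdiff_subset
  have hbY : b ∉ Y := fun h => (mem_sdiff.1 (mem_of_mem_erase h)).2 hbX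
  have heY : e ∈ Y := mem_erase.2 ⟨hT.hpe.symm, mem_sdiff.2 ⟨hT.he, heX⟩⟩
  have hpY : p ∉ Y := notMem_erase p _
  have hZ : insert p Y = gr M \ X := insert_erase hpZ
  have hYr : rk M Y = Y.card := rk_eq_card_of_subset_of_rk_eq_card (erase_subset _ _) hXc
  have hpYcl : p ∉ clF M Y := by
    apply notMem_clF_of_rk_insert hT.hp hYg hpY
    rw [hZ]
    exact hXc
  have hbYcl : b ∉ clF M Y := by
    intro hb
    exact hpYcl (hT.p_mem_clF_of hYg (subset_clF_self_of_subset_gr hYg heY) hb)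
  have hreY : rk M (insert b Y) = (insert b Y).card := rk_insert_eq_card_of_notMem_clF hT.hb hYg hYr hbY hbYcl
  have hcomp : gr M \ insert b Y = insert p (X.erase b) := by
    rw [sdiff_insert, hYdef, sdiff_sdiff_erase hT.hp hXg hpX, erase_insert_of_ne hT.hpb]
  have hXbg : X.erase b ⊆ gr M := (erase_subset _ _).trans hXg
  have hpXb' : p ∉ X.erase b := fun h => hpX (mem_of_mem_erase h)
  have hXbr : rk M (X.erase b) = (X.erase b).card := rk_eq_card_of_subset_of_rk_eq_card (erase_subset _ _) hXr
  have hrpXb : rk M (insert p (X.erase b)) = (insert p (X.erase b)).card :=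
    rk_insert_eq_card_of_notMem_clF hT.hp hXbg hXbr hpXb' hpXb
  have hpcl' : p ∈ clF M (insert b Y) := by
    apply clF_mono_sub _ hT.p_mem_clF
    intro w hw
    rw [mem_insert, mem_singleton] at hw
    rcases hw with rfl | rfl
    · exact mem_insert_of_mem heY
    · exact mem_insert_self _ _
  have hbcl : b ∈ clF M (insert p (X.erase b)) := by
    rw [mem_clF_iff_rk_insert_eq hT.hb (insert_subset hT.hp hXbg), hrpXb, insert_comm, insert_erase hbX,
      (mem_clF_iff_rk_insert_eq hT.hp hXg).1 hpcl, hXr, card_insert_of_notMem hpXb', card_erase_of_mem hbX]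
    have := card_pos.2 ⟨b, hbX⟩
    omega
  have hecl : e ∈ clF M (insert p (X.erase b)) :=
    hT.e_mem_clF_of (insert_subset hT.hp hXbg) (subset_clF_self_of_subset_gr (insert_subset hT.hp hXbg)
      (mem_insert_self _ _)) hbcl
  unfold tau
  rw [← hYdef]
  refine ⟨?_, mem_insert_of_mem heY, ?_, hcomp⟩
  · rw [mem_capSets, mem_biIndepAll]
    refine ⟨⟨⟨insert_subset hT.hb hYg, hreY, ?_⟩, ?_⟩, hpcl'⟩
    · rw [hcomp]
      exact hrpXb
    · rw [mem_insert, not_or]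
      exact ⟨hT.hpb, hpY⟩
  · rw [hcomp]
    exact hecl

/-- `τ X ∈ swapPart e ∨ τ X ∈ restPart e` for `X ∈ P₁′`. -/
theorem IsTriangle.tau_mem_swap_or_rest (hT : IsTriangle M p e b) {X : Finset α} (hX : X ∈ triP1' M p e b) :
    tau M p b X ∈ swapPart M p e ∨ tau M p b X ∈ restPart M p e := by
  obtain ⟨hK, heT, hecl, -⟩ := hT.tau_mem hX
  unfold swapPart restPart
  rw [mem_filter, mem_filter]
  by_cases h : e ∉ clF M ((gr M \ tau M p b X).erase p) ∧ p ∉ clF M ((tau M p b X).erase e)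
  · exact Or.inl ⟨hK, heT, hecl, h⟩
  · exact Or.inr ⟨hK, heT, hecl, h⟩

/-- **THE INVERSE OF `τ` ON `restPart e ∩ {b ∈ Z}`**: for `Z ∈ restPart e` with `b ∈ Z`, `τ Z ∈ P₁′` and
`τ (τ Z) = Z`. -/
theorem IsTriangle.tau_mem_triP1'_of_rest (hT : IsTriangle M p e b) {Z : Finset α} (hZ : Z ∈ restPart M p e)
    (hbZ : b ∈ Z) : tau M p b Z ∈ triP1' M p e b := by
  unfold restPart at hZ
  rw [mem_filter] at hZ
  obtain ⟨hZK, heZ, hecl, hrest⟩ := hZ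
  obtain ⟨⟨hZb, hpZ⟩, hpcl⟩ := mem_capSets.1 hZK
  obtain ⟨hZg, hZr, hZc⟩ := mem_biIndepAll.1 hZb
  have hpW : p ∈ gr M \ Z := mem_sdiff.2 ⟨hT.hp, hpZ⟩
  set W := (gr M \ Z).erase p with hWdef
  have hWg : W ⊆ gr M := (erase_subset _ _).trans sdiff_subset
  have hbW : b ∉ W := fun h => (mem_sdiff.1 (mem_of_mem_erase h)).2 hbZ
  have heW : e ∉ W := fun h => (mem_sdiff.1 (mem_of_mem_erase h)).2 heZ
  have hpW' : p ∉ W := notMem_erase p _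
  have hW : insert p W = gr M \ Z := insert_erase hpW
  have hWr : rk M W = W.card := rk_eq_card_of_subset_of_rk_eq_card (erase_subset _ _) hZc
  have hpWcl : p ∉ clF M W := by
    apply notMem_clF_of_rk_insert hT.hp hWg hpW'
    rw [hW]
    exact hZc
  -- the rest condition must be `e ∈ cl W`: `p ∈ cl (Z ∖ e)` is impossible since `e, b ∈ Z`
  have heWcl : e ∈ clF M W := by
    by_contra heW'
    apply hrest
    refine ⟨heW', hT.notMem_clF_erase_of_mem_of_mem hZK heZ hbZ⟩
  have hbWcl : b ∉ clF M W := fun hb => hpWcl (hT.p_mem_clF_of hWg heWcl hb)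
  have hrW : rk M (insert b W) = (insert b W).card := rk_insert_eq_card_of_notMem_clF hT.hb hWg hWr hbW hbWcl
  have hcomp : gr M \ insert b W = insert p (Z.erase b) := by
    rw [sdiff_insert, hWdef, sdiff_sdiff_erase hT.hp hZg hpZ, erase_insert_of_ne hT.hpb]
  have hZbg : Z.erase b ⊆ gr M := (erase_subset _ _).trans hZg
  have hpZb : p ∉ Z.erase b := fun h => hpZ (mem_of_mem_erase h)
  have hZbr : rk M (Z.erase b) = (Z.erase b).card := rk_eq_card_of_subset_of_rk_eq_card (erase_subset _ _) hZr
  have hrpZb : rk M (insert p (Z.erase b)) = (insert p (Z.erase b)).card :=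
    rk_insert_eq_card_of_notMem_clF hT.hp hZbg hZbr hpZb (hT.notMem_clF_erase_of_mem_of_mem' hZK heZ hbZ)
  have hpcl' : p ∈ clF M (insert b W) :=
    hT.p_mem_clF_of (insert_subset hT.hb hWg) (clF_mono_sub (subset_insert b W) heWcl)
      (subset_clF_self_of_subset_gr (insert_subset hT.hb hWg) (mem_insert_self _ _))
  unfold triP1' tau
  rw [← hWdef, mem_filter, mem_capSets, mem_biIndepAll]
  refine ⟨⟨⟨⟨insert_subset hT.hb hWg, hrW, ?_⟩, ?_⟩, hpcl'⟩, ?_, ?_⟩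
  · rw [hcomp]
    exact hrpZb
  · rw [mem_insert, not_or]
    exact ⟨hT.hpb, hpW'⟩
  · rw [mem_insert, not_or]
    exact ⟨hT.heb, heW⟩
  · rw [erase_insert hbW]
    exact hpWcl

/-- **THE `τ`-PART OF `restPart e`**: `Σ_{Z ∈ restPart e, b ∈ Z} (2 #Z − N) = − Σ_{X ∈ P₁′ ∖ F₂} (2 #X − N)`. -/
theorem IsTriangle.sum_restPart_mem_eq_neg_sum (hT : IsTriangle M p e b) :
    ∑ Z ∈ (restPart M p e).filter (fun Z => b ∈ Z), (2 * (Z.card : ℤ) - (gr M).card) =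
      - ∑ X ∈ (triP1' M p e b).filter (fun X => tau M p b X ∉ swapPart M p e),
          (2 * (X.card : ℤ) - (gr M).card) := by
  rw [← sum_neg_distrib]
  symm
  apply sum_nbij' (fun X => tau M p b X) (fun Z => tau M p b Z)
  · intro X hX
    rw [mem_filter] at hX
    obtain ⟨hX1, hnot⟩ := hX
    have hrest := (hT.tau_mem_swap_or_rest hX1).resolve_left hnot
    rw [mem_filter]
    refine ⟨hrest, ?_⟩
    unfold tau
    exact mem_insert_self _ _
  · intro Z hZ
    rw [mem_filter] at hZ
    obtain ⟨hZr, hbZ⟩ := hZ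
    rw [mem_filter]
    refine ⟨hT.tau_mem_triP1'_of_rest hZr hbZ, ?_⟩
    -- `τ (τ Z) = Z ∈ restPart`, which is disjoint from `swapPart`
    have hZK : Z ∈ capSets M p := (mem_filter.1 hZr).1
    obtain ⟨⟨hZb, hpZ⟩, -⟩ := mem_capSets.1 hZK
    have hZg : Z ⊆ gr M := (mem_biIndepAll.1 hZb).1
    rw [tau_tau hT.hp hT.hpb hZg hpZ hbZ]
    intro hsw
    unfold swapPart at hsw
    unfold restPart at hZr
    rw [mem_filter] at hsw hZr
    exact hZr.2.2.2 hsw.2.2.2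
  · intro X hX
    rw [mem_filter] at hX
    have hX1 := hX.1
    unfold triP1' at hX1
    rw [mem_filter] at hX1
    obtain ⟨hXK, heX, -⟩ := hX1
    have hbX : b ∈ X := (hT.mem_or_mem hXK).resolve_left heX
    obtain ⟨⟨hXb, hpX⟩, -⟩ := mem_capSets.1 hXK
    exact tau_tau hT.hp hT.hpb (mem_biIndepAll.1 hXb).1 hpX hbX
  · intro Z hZ
    rw [mem_filter] at hZ
    have hZK : Z ∈ capSets M p := (mem_filter.1 hZ.1).1
    obtain ⟨⟨hZb, hpZ⟩, -⟩ := mem_capSets.1 hZK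
    exact tau_tau hT.hp hT.hpb (mem_biIndepAll.1 hZb).1 hpZ hZ.2
  · intro X hX
    rw [mem_filter] at hX
    have hX1 := hX.1
    unfold triP1' at hX1
    rw [mem_filter] at hX1
    obtain ⟨hXK, heX, -⟩ := hX1
    have hbX : b ∈ X := (hT.mem_or_mem hXK).resolve_left heX
    have h := card_tau_add hT.hp hXK hbX
    have h' : ((tau M p b X).card : ℤ) + X.card = (gr M).card := by exact_mod_cast h
    linarith

end PercRepro.Cogirth
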